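import Summits.AtomisticToContinuum.HydrodynamicLimit.Theorems.ImplosionDichotomyPolynomialCompressionLevel3CrudeDensity
import Summits.AtomisticToContinuum.HydrodynamicLimit.Theorems.ImplosionDichotomyPolynomialCompressionLevel3CrudeVelocity
import Summits.AtomisticToContinuum.HydrodynamicLimit.Theorems.ImplosionDichotomyPolynomialCompressionLevel3CrudeTemperature
import Summits.AtomisticToContinuum.HydrodynamicLimit.Theorems.ImplosionDichotomyPolynomialCompressionFAudit
import Summits.AtomisticToContinuum.HydrodynamicLimit.Theorems.ImplosionDichotomyPolynomialCompressionCommAudit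
import Summits.AtomisticToContinuum.HydrodynamicLimit.Theorems.ImplosionDichotomyPolynomialCompressionCommAuditDelta
import Summits.AtomisticToContinuum.HydrodynamicLimit.Theorems.ImplosionDichotomyPolynomialCompressionWeightTransport
import Summits.AtomisticToContinuum.HydrodynamicLimit.Theorems.ImplosionDichotomyPolynomialCompressionTorusJetCalculus
import Summits.AtomisticToContinuum.HydrodynamicLimit.Theorems.ImplosionDichotomyPolynomialCompressionIsentropicCalculus

/-!
# Level-3 pairing bound at a point (line `log-lipschitz-budget`, stub 4, level 3)

Helper file for the crux `ImplosionDichotomy.PolynomialCompression` (stmt-AtomisticToContinuum-12587), stub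
`stub_logBudgetShadowing` (vocabulary `…Level3Defs`). For a word `(l,m,n)`, `W = ∂ₙ∂ₘ∂ₗ δV` and `F = P_V W` (`l3Fρ/l3Fu/l3Fθ`),
at a point of the weak bootstrap regime the weighted pairing `A W_ρ F_ρ + ρ Σⱼ W_uⱼ F_uⱼ + B W_θ F_θ` is at most
`(Λ/λ)(l3e + l3Y)` — the TOP-ORDER part (`l3Top*`), Type I by the audits `shadow_fAudit_pointwise`,
`shadow_commAudit_pointwise`, `shadow_commAuditDelta_pointwise` (chain rules `∂ₗA = A_θ ∂ₗθ + A_ρ ∂ₗρ`, `∂ₗζ(ρ) = ζ'∂ₗρ`,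
`∂ₗ(θζ) = ζ∂ₗθ + θζ'∂ₗρ`; isentropic reference `ρ₁ = c₁³`, `θ₁ = Kc₁²`) — plus the CRUDE part `3 · l3Nw · l3Ws · l3Rem`
from `level3_crude_density/velocity/temperature`.
-/

noncomputable section

namespace Summit.AtomisticToContinuum.HydrodynamicLimit.Theorems

open Set MeasureTheory
open Literature.MathematicalPhysics.KineticTheory Literature.Analysis.FunctionSpaces

/-- Reference part plus δ-part of a commutator pairing (the left-hand sides of `shadow_commAudit_pointwise` and
`shadow_commAuditDelta_pointwise` at the jets `-Y`) recombine to minus the pairing of the commutator top with the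
full σ-coefficients `∂ₚuᵢ = du i`, `∂ₚρ = dR`, `∂ₚθ = dT` (chain rules `∂ₚA = (γ/ρ)∂ₚθ + θ(2ζ₁+ζ₂-γ)/ρ² ∂ₚρ`,
`∂ₚζ(ρ) = (ζ₁/ρ)∂ₚρ`, `∂ₚ(θζ) = ζ₀∂ₚθ + θ(ζ₁/ρ)∂ₚρ`, `γ = ζ₀ + ζ₁`). [folklore] -/
private theorem l3pb_dir_id (K c₁ ρ θ ζ0 ζ1 ζ2 a b dc dR dT : ℝ) (w du du₁ Yρ Yθ : Fin 3 → ℝ)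
    (Yu : Fin 3 → Fin 3 → ℝ) :
    θ * (ζ0 + ζ1) / ρ * a * (∑ m, du₁ m * -Yρ m + 3 * c₁ ^ 2 * dc * ∑ m, -Yu m m) +
        ρ * ∑ j, w j * (∑ m, du₁ m * -Yu m j +
          ((ζ0 + ζ1) / ρ * (2 * K * c₁ * dc) + θ * (2 * ζ1 + ζ2 - (ζ0 + ζ1)) / ρ ^ 2 * (3 * c₁ ^ 2 * dc)) *
            -Yρ j + ζ1 / ρ * (3 * c₁ ^ 2 * dc) * -Yθ j) +
        3 / 2 * ρ / θ * b * (∑ m, du₁ m * -Yθ m +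
          2 / 3 * (ζ0 * (2 * K * c₁ * dc) + θ * (ζ1 / ρ) * (3 * c₁ ^ 2 * dc)) * ∑ m, -Yu m m) +
      (θ * (ζ0 + ζ1) / ρ * a *
          (∑ m, (du m - du₁ m) * -Yρ m + (dR - 3 * c₁ ^ 2 * dc) * ∑ m, -Yu m m) +
        ρ * ∑ j, w j * (∑ m, (du m - du₁ m) * -Yu m j +
          ((ζ0 + ζ1) / ρ * (dT - 2 * K * c₁ * dc) +
              θ * (2 * ζ1 + ζ2 - (ζ0 + ζ1)) / ρ ^ 2 * (dR - 3 * c₁ ^ 2 * dc)) * -Yρ j +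
          ζ1 / ρ * (dR - 3 * c₁ ^ 2 * dc) * -Yθ j) +
        3 / 2 * ρ / θ * b * (∑ m, (du m - du₁ m) * -Yθ m +
          2 / 3 * (ζ0 * (dT - 2 * K * c₁ * dc) + θ * (ζ1 / ρ) * (dR - 3 * c₁ ^ 2 * dc)) * ∑ m, -Yu m m)) =
      -(θ * (ζ0 + ζ1) / ρ * a * (∑ i, du i * Yρ i + dR * ∑ i, Yu i i) +
          ρ * ∑ j, w j * (∑ i, du i * Yu i j +
            ((ζ0 + ζ1) / ρ * dT + θ * (2 * ζ1 + ζ2 - (ζ0 + ζ1)) / ρ ^ 2 * dR) * Yρ j +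
            ζ1 / ρ * dR * Yθ j) +
          3 / 2 * ρ / θ * b * (∑ i, du i * Yθ i + 2 / 3 * (ζ0 * dT + θ * (ζ1 / ρ) * dR) * ∑ i, Yu i i)) := by
  simp only [Fin.sum_univ_three]
  ring

/-- The top-order pairing regrouped: linear forcing part (left-hand side of `shadow_fAudit_pointwise`) plus the
three commutator parts (right-hand side of `l3pb_dir_id`). [folklore] -/
private theorem l3pb_top_id (K c₁ ρ θ ζ0 ζ1 ζ2 a b : ℝ) (w dc₁ dρ dθ Yρl Yθl Yρm Yθm Yρn Yθn : Fin 3 → ℝ)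
    (du du₁ Yul Yum Yun : Fin 3 → Fin 3 → ℝ) (l m n : Fin 3) :
    θ * (ζ0 + ζ1) / ρ * a *
          (-(a * ∑ i, du₁ i i) - ∑ i, w i * (3 * c₁ ^ 2 * dc₁ i) -
            (∑ i, du l i * Yρl i + dρ l * ∑ i, Yul i i) -
            (∑ i, du m i * Yρm i + dρ m * ∑ i, Yum i i) -
            (∑ i, du n i * Yρn i + dρ n * ∑ i, Yun i i)) +
        ρ * ∑ j, w j *
          (-(∑ i, w i * du₁ i j) - b * ((ζ0 + ζ1) / ρ * (3 * c₁ ^ 2 * dc₁ j)) +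
              a * (K * c₁ ^ 2 / (ρ * c₁ ^ 3) * (3 * c₁ ^ 2 * dc₁ j)) -
            (∑ i, du l i * Yul i j +
              ((ζ0 + ζ1) / ρ * dθ l + θ * (2 * ζ1 + ζ2 - (ζ0 + ζ1)) / ρ ^ 2 * dρ l) * Yρl j +
              ζ1 / ρ * dρ l * Yθl j) -
            (∑ i, du m i * Yum i j +
              ((ζ0 + ζ1) / ρ * dθ m + θ * (2 * ζ1 + ζ2 - (ζ0 + ζ1)) / ρ ^ 2 * dρ m) * Yρm j +
              ζ1 / ρ * dρ m * Yθm j) -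
            (∑ i, du n i * Yun i j +
              ((ζ0 + ζ1) / ρ * dθ n + θ * (2 * ζ1 + ζ2 - (ζ0 + ζ1)) / ρ ^ 2 * dρ n) * Yρn j +
              ζ1 / ρ * dρ n * Yθn j)) +
        3 / 2 * ρ / θ * b *
          (-(∑ i, w i * (2 * K * c₁ * dc₁ i)) - 2 / 3 * b * (ζ0 * ∑ i, du₁ i i) -
            (∑ i, du l i * Yθl i + 2 / 3 * (ζ0 * dθ l + θ * (ζ1 / ρ) * dρ l) * ∑ i, Yul i i) -
            (∑ i, du m i * Yθm i + 2 / 3 * (ζ0 * dθ m + θ * (ζ1 / ρ) * dρ m) * ∑ i, Yum i i) -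
            (∑ i, du n i * Yθn i + 2 / 3 * (ζ0 * dθ n + θ * (ζ1 / ρ) * dρ n) * ∑ i, Yun i i)) =
      θ * (ζ0 + ζ1) / ρ * a * (-(a * ∑ i, du₁ i i) - ∑ i, w i * (3 * c₁ ^ 2 * dc₁ i)) +
          ρ * ∑ j, w j * (-(∑ i, w i * du₁ i j) - b * (ζ0 + ζ1) / ρ * (3 * c₁ ^ 2 * dc₁ j) +
            K * c₁ ^ 2 * a / (ρ * c₁ ^ 3) * (3 * c₁ ^ 2 * dc₁ j)) +
          3 / 2 * ρ / θ * b * (-(∑ i, w i * (2 * K * c₁ * dc₁ i)) - 2 / 3 * ζ0 * b * ∑ i, du₁ i i) +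
        -(θ * (ζ0 + ζ1) / ρ * a * (∑ i, du l i * Yρl i + dρ l * ∑ i, Yul i i) +
            ρ * ∑ j, w j * (∑ i, du l i * Yul i j +
              ((ζ0 + ζ1) / ρ * dθ l + θ * (2 * ζ1 + ζ2 - (ζ0 + ζ1)) / ρ ^ 2 * dρ l) * Yρl j +
              ζ1 / ρ * dρ l * Yθl j) +
            3 / 2 * ρ / θ * b * (∑ i, du l i * Yθl i + 2 / 3 * (ζ0 * dθ l + θ * (ζ1 / ρ) * dρ l) * ∑ i, Yul i i)) +
        -(θ * (ζ0 + ζ1) / ρ * a * (∑ i, du m i * Yρm i + dρ m * ∑ i, Yum i i) +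
            ρ * ∑ j, w j * (∑ i, du m i * Yum i j +
              ((ζ0 + ζ1) / ρ * dθ m + θ * (2 * ζ1 + ζ2 - (ζ0 + ζ1)) / ρ ^ 2 * dρ m) * Yρm j +
              ζ1 / ρ * dρ m * Yθm j) +
            3 / 2 * ρ / θ * b * (∑ i, du m i * Yθm i + 2 / 3 * (ζ0 * dθ m + θ * (ζ1 / ρ) * dρ m) * ∑ i, Yum i i)) +
        -(θ * (ζ0 + ζ1) / ρ * a * (∑ i, du n i * Yρn i + dρ n * ∑ i, Yun i i) +
            ρ * ∑ j, w j * (∑ i, du n i * Yun i j +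
              ((ζ0 + ζ1) / ρ * dθ n + θ * (2 * ζ1 + ζ2 - (ζ0 + ζ1)) / ρ ^ 2 * dρ n) * Yρn j +
              ζ1 / ρ * dρ n * Yθn j) +
            3 / 2 * ρ / θ * b * (∑ i, du n i * Yθn i + 2 / 3 * (ζ0 * dθ n + θ * (ζ1 / ρ) * dρ n) * ∑ i, Yun i i)) := by
  simp only [Fin.sum_univ_three]
  ring

/-- Assembly of the four Type-I inequalities with `Λ := Λ_f + 3(Λ_c + Λ_d)`. [folklore] -/
private theorem l3pb_assemble {Λf Λc Λd lam P F Nl Nm Nn E Y Yl Ym Yn : ℝ}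
    (hΛf : 0 ≤ Λf) (hΛc : 0 ≤ Λc) (hΛd : 0 ≤ Λd) (hlam : 0 < lam)
    (hP : P = F + Nl + Nm + Nn) (hF : F ≤ Λf / lam * E)
    (hl : Nl ≤ Λc / lam * (E + Yl) + Λd / lam * (E + Yl))
    (hm : Nm ≤ Λc / lam * (E + Ym) + Λd / lam * (E + Ym))
    (hn : Nn ≤ Λc / lam * (E + Yn) + Λd / lam * (E + Yn))
    (hYl : 0 ≤ Yl) (hYm : 0 ≤ Ym) (hYn : 0 ≤ Yn) (hY : Yl + Ym + Yn = Y) :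
    P ≤ (Λf + 3 * (Λc + Λd)) / lam * (E + Y) := by
  rw [hP, ← hY]
  have hi : (0 : ℝ) ≤ lam⁻¹ := inv_nonneg.2 hlam.le
  simp only [div_eq_mul_inv] at hF hl hm hn ⊢
  linarith [mul_nonneg (mul_nonneg hΛf hi) hYl, mul_nonneg (mul_nonneg hΛf hi) hYm,
    mul_nonneg (mul_nonneg hΛf hi) hYn, mul_nonneg (mul_nonneg hΛc hi) hYl,
    mul_nonneg (mul_nonneg hΛc hi) hYm, mul_nonneg (mul_nonneg hΛc hi) hYn,
    mul_nonneg (mul_nonneg hΛd hi) hYl, mul_nonneg (mul_nonneg hΛd hi) hYm,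
    mul_nonneg (mul_nonneg hΛd hi) hYn]

/-- **Top-order part, pure real form**: the weighted pairing of `W` with the top-order part of `P_V W` (linear
forcing + three commutators, coefficients split into isentropic reference and δ parts) is Type I, by
`shadow_fAudit_pointwise`, `shadow_commAudit_pointwise`, `shadow_commAuditDelta_pointwise`. [folklore] -/
private theorem l3pb_real (K C Cb cZ : ℝ) (hK : 0 < K) (hC : 0 ≤ C) (hCb : 0 ≤ Cb) (hcZ : 0 ≤ cZ) :
    ∃ Λ : ℝ, 0 ≤ Λ ∧
      ∀ (lam c₁ ρ θ ζ0 ζ1 ζ2 ηh : ℝ) (du du₁ : Fin 3 → Fin 3 → ℝ) (dc₁ dρ dθ : Fin 3 → ℝ) (a b : ℝ)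
        (w Yρl Yθl Yρm Yθm Yρn Yθn : Fin 3 → ℝ) (Yul Yum Yun : Fin 3 → Fin 3 → ℝ) (l m n : Fin 3),
        0 < lam → 0 < c₁ → 0 ≤ ηh → ηh * (cZ + 1) ≤ 1 / 8 →
        |ζ0 - 1| ≤ cZ * ηh → |ζ1| ≤ cZ * ηh → |ζ2| ≤ cZ * ηh →
        |ρ - c₁ ^ 3| ≤ c₁ ^ 3 / 2 → |θ - K * c₁ ^ 2| ≤ K * c₁ ^ 2 / 2 →
        (∀ i j, |du₁ i j| ≤ C / lam) → (∀ i, |dc₁ i| ≤ C / lam) →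
        (∀ i j, |du i j - du₁ i j| ≤ Cb / lam) →
        (∀ i, Real.sqrt K * c₁ * |dρ i - 3 * c₁ ^ 2 * dc₁ i| / c₁ ^ 3 ≤ Cb / lam) →
        (∀ i, |dθ i - 2 * K * c₁ * dc₁ i| / (Real.sqrt K * c₁) ≤ Cb / lam) →
        θ * (ζ0 + ζ1) / ρ * a *
              (-(a * ∑ i, du₁ i i) - ∑ i, w i * (3 * c₁ ^ 2 * dc₁ i) -
                (∑ i, du l i * Yρl i + dρ l * ∑ i, Yul i i) -
                (∑ i, du m i * Yρm i + dρ m * ∑ i, Yum i i) -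
                (∑ i, du n i * Yρn i + dρ n * ∑ i, Yun i i)) +
            ρ * ∑ j, w j *
              (-(∑ i, w i * du₁ i j) - b * ((ζ0 + ζ1) / ρ * (3 * c₁ ^ 2 * dc₁ j)) +
                  a * (K * c₁ ^ 2 / (ρ * c₁ ^ 3) * (3 * c₁ ^ 2 * dc₁ j)) -
                (∑ i, du l i * Yul i j +
                  ((ζ0 + ζ1) / ρ * dθ l + θ * (2 * ζ1 + ζ2 - (ζ0 + ζ1)) / ρ ^ 2 * dρ l) * Yρl j +
                  ζ1 / ρ * dρ l * Yθl j) -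
                (∑ i, du m i * Yum i j +
                  ((ζ0 + ζ1) / ρ * dθ m + θ * (2 * ζ1 + ζ2 - (ζ0 + ζ1)) / ρ ^ 2 * dρ m) * Yρm j +
                  ζ1 / ρ * dρ m * Yθm j) -
                (∑ i, du n i * Yun i j +
                  ((ζ0 + ζ1) / ρ * dθ n + θ * (2 * ζ1 + ζ2 - (ζ0 + ζ1)) / ρ ^ 2 * dρ n) * Yρn j +
                  ζ1 / ρ * dρ n * Yθn j)) +
            3 / 2 * ρ / θ * b *
              (-(∑ i, w i * (2 * K * c₁ * dc₁ i)) - 2 / 3 * b * (ζ0 * ∑ i, du₁ i i) -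
                (∑ i, du l i * Yθl i + 2 / 3 * (ζ0 * dθ l + θ * (ζ1 / ρ) * dρ l) * ∑ i, Yul i i) -
                (∑ i, du m i * Yθm i + 2 / 3 * (ζ0 * dθ m + θ * (ζ1 / ρ) * dρ m) * ∑ i, Yum i i) -
                (∑ i, du n i * Yθn i + 2 / 3 * (ζ0 * dθ n + θ * (ζ1 / ρ) * dρ n) * ∑ i, Yun i i))
          ≤ Λ / lam *
            (1 / 2 * (θ * (ζ0 + ζ1) / ρ * a ^ 2 + ρ * ∑ i, w i ^ 2 + 3 / 2 * ρ / θ * b ^ 2) +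
              ∑ i, (1 / 2 * (θ * (ζ0 + ζ1) / ρ * Yρl i ^ 2 + ρ * ∑ j, Yul i j ^ 2 +
                  3 / 2 * ρ / θ * Yθl i ^ 2) +
                1 / 2 * (θ * (ζ0 + ζ1) / ρ * Yρm i ^ 2 + ρ * ∑ j, Yum i j ^ 2 +
                  3 / 2 * ρ / θ * Yθm i ^ 2) +
                1 / 2 * (θ * (ζ0 + ζ1) / ρ * Yρn i ^ 2 + ρ * ∑ j, Yun i j ^ 2 +
                  3 / 2 * ρ / θ * Yθn i ^ 2))) := by
  obtain ⟨Λf, hΛf, hF⟩ := shadow_fAudit_pointwise K C cZ hK hC hcZ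
  obtain ⟨Λc, hΛc, hCm⟩ := shadow_commAudit_pointwise K C cZ hK hC hcZ
  obtain ⟨Λd, hΛd, hD⟩ := shadow_commAuditDelta_pointwise K Cb cZ hK hCb hcZ
  refine ⟨Λf + 3 * (Λc + Λd), by positivity, ?_⟩
  intro lam c₁ ρ θ ζ0 ζ1 ζ2 ηh du du₁ dc₁ dρ dθ a b w Yρl Yθl Yρm Yθm Yρn Yθn Yul Yum Yun l m n
    hlam hc₁ hηh hηcZ hζ0 hζ1 hζ2 hρ hθ hdu₁ hdc₁ hdu hdρ hdθ
  have hf := hF lam c₁ ρ θ ζ0 ζ1 ηh du₁ dc₁ a b w hlam hc₁ hηh hηcZ hζ0 hζ1 hρ hθ hdu₁ hdc₁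
  have hN := fun (p : Fin 3) (Yρ Yθ : Fin 3 → ℝ) (Yu : Fin 3 → Fin 3 → ℝ) =>
    (l3pb_dir_id K c₁ ρ θ ζ0 ζ1 ζ2 a b (dc₁ p) (dρ p) (dθ p) w (du p) (du₁ p) Yρ Yθ Yu).symm.trans_le
      (add_le_add (hCm lam c₁ ρ θ ζ0 ζ1 ζ2 ηh du₁ dc₁ a b w (fun i => -Yρ i) (fun i => -Yθ i)
        (fun i j => -Yu i j) p hlam hc₁ hηh hηcZ hζ0 hζ1 hζ2 hρ hθ hdu₁ hdc₁)
        (hD lam c₁ ρ θ ζ0 ζ1 ζ2 ηh du du₁ dc₁ dρ dθ a b w (fun i => -Yρ i) (fun i => -Yθ i)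
          (fun i j => -Yu i j) p hlam hc₁ hηh hηcZ hζ0 hζ1 hζ2 hρ hθ (hdu p) (hdρ p) (hdθ p)))
  have hsmall : cZ * ηh ≤ 1 / 8 := by linarith
  have hc3 : 0 < c₁ ^ 3 := by positivity
  have hKc : 0 < K * c₁ ^ 2 := by positivity
  have hρpos : 0 < ρ := by linarith [(abs_le.1 hρ).1]
  have hθpos : 0 < θ := by linarith [(abs_le.1 hθ).1]
  have hγ : 0 < ζ0 + ζ1 := by
    linarith [(abs_le.1 (hζ0.trans hsmall)).1, (abs_le.1 (hζ1.trans hsmall)).1]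
  have hA0 : 0 ≤ θ * (ζ0 + ζ1) / ρ := div_nonneg (mul_nonneg hθpos.le hγ.le) hρpos.le
  have hB0 : 0 ≤ 3 / 2 * ρ / θ := by positivity
  have hYp : ∀ (Yρ Yθ : Fin 3 → ℝ) (Yu : Fin 3 → Fin 3 → ℝ),
      0 ≤ 1 / 2 * ∑ m, (θ * (ζ0 + ζ1) / ρ * (-Yρ m) ^ 2 + ρ * ∑ j, (-Yu m j) ^ 2 +
        3 / 2 * ρ / θ * (-Yθ m) ^ 2) := fun Yρ Yθ Yu =>
    mul_nonneg (by norm_num) (Finset.sum_nonneg fun m _ => add_nonneg (add_nonneg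
      (mul_nonneg hA0 (sq_nonneg _)) (mul_nonneg hρpos.le (Finset.sum_nonneg fun j _ => sq_nonneg _)))
      (mul_nonneg hB0 (sq_nonneg _)))
  refine l3pb_assemble hΛf hΛc hΛd hlam (l3pb_top_id K c₁ ρ θ ζ0 ζ1 ζ2 a b w dc₁ dρ dθ Yρl Yθl Yρm
    Yθm Yρn Yθn du du₁ Yul Yum Yun l m n) hf (hN l Yρl Yθl Yul) (hN m Yρm Yθm Yum) (hN n Yρn Yθn Yun)
    (hYp Yρl Yθl Yul) (hYp Yρm Yθm Yum) (hYp Yρn Yθn Yun) ?_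
  simp only [Fin.sum_univ_three]
  ring

/-- **Crude part, pure real form**: pairing the weighted top field with differences bounded by `R` costs at most
`3 · (√A|a| + √ρ N + √B|b|) · (√A + √ρ + √B) · R` (`|w j| ≤ N`). [folklore] -/
private theorem l3pb_crude_real {A ρ B a b R N Fρ Tρ Fθ Tθ : ℝ} {w Fu Tu : Fin 3 → ℝ}
    (hA : 0 ≤ A) (hρ : 0 ≤ ρ) (hB : 0 ≤ B) (hρb : |Fρ - Tρ| ≤ R) (hub : ∀ j, |Fu j - Tu j| ≤ R)
    (hθb : |Fθ - Tθ| ≤ R) (hw : ∀ j, |w j| ≤ N) :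
    A * a * (Fρ - Tρ) + ρ * ∑ j, w j * (Fu j - Tu j) + B * b * (Fθ - Tθ) ≤
      3 * (Real.sqrt A * |a| + Real.sqrt ρ * N + Real.sqrt B * |b|) *
        (Real.sqrt A + Real.sqrt ρ + Real.sqrt B) * R := by
  have hR : 0 ≤ R := (abs_nonneg _).trans hρb
  have hN : 0 ≤ N := (abs_nonneg _).trans (hw 0)
  have hmm : ∀ {p q P : ℝ}, |p| ≤ P → |q| ≤ R → p * q ≤ P * R := fun hp hq =>
    (le_abs_self _).trans (by rw [abs_mul]; exact mul_le_mul hp hq (abs_nonneg _) ((abs_nonneg _).trans hp))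
  have h1 : A * a * (Fρ - Tρ) ≤ A * (|a| * R) := by
    rw [mul_assoc]; exact mul_le_mul_of_nonneg_left (hmm le_rfl hρb) hA
  have h2 : ρ * ∑ j, w j * (Fu j - Tu j) ≤ ρ * (3 * (N * R)) := by
    refine mul_le_mul_of_nonneg_left ?_ hρ
    simp only [Fin.sum_univ_three]
    linarith [hmm (hw 0) (hub 0), hmm (hw 1) (hub 1), hmm (hw 2) (hub 2)]
  have h3 : B * b * (Fθ - Tθ) ≤ B * (|b| * R) := by
    rw [mul_assoc]; exact mul_le_mul_of_nonneg_left (hmm le_rfl hθb) hB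
  obtain ⟨hqA, hqρ, hqB⟩ := And.intro (Real.sqrt_nonneg A) (And.intro (Real.sqrt_nonneg ρ) (Real.sqrt_nonneg B))
  have hsA : Real.sqrt A * Real.sqrt A * |a| = A * |a| := by rw [Real.mul_self_sqrt hA]
  have hsρ : Real.sqrt ρ * Real.sqrt ρ * N = ρ * N := by rw [Real.mul_self_sqrt hρ]
  have hsB : Real.sqrt B * Real.sqrt B * |b| = B * |b| := by rw [Real.mul_self_sqrt hB]
  have hx : A * |a| + ρ * N + B * |b| ≤ (Real.sqrt A * |a| + Real.sqrt ρ * N + Real.sqrt B * |b|) *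
      (Real.sqrt A + Real.sqrt ρ + Real.sqrt B) := by
    linarith [mul_nonneg (mul_nonneg hqA (abs_nonneg a)) (add_nonneg hqρ hqB),
      mul_nonneg (mul_nonneg hqρ hN) (add_nonneg hqA hqB),
      mul_nonneg (mul_nonneg hqB (abs_nonneg b)) (add_nonneg hqA hqρ)]
  have hx' := mul_le_mul_of_nonneg_right hx hR
  linarith [mul_nonneg (mul_nonneg hA (abs_nonneg a)) hR, mul_nonneg (mul_nonneg hB (abs_nonneg b)) hR]

/-- Chain rules for the σ-coefficients of the commutator tops at a point (`ζ₀ = ζ(ρ)`, `ζ₁ = ρζ'(ρ)`,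
`ζ₂ = ρ²ζ''(ρ)`): `∂ᵢζ(ρ) = (ζ₁/ρ)∂ᵢρ`, `∂ᵢ(θζ(ρ)) = ζ₀∂ᵢθ + θ(ζ₁/ρ)∂ᵢρ`,
`∂ᵢ(θγ(ρ)/ρ) = (γ/ρ)∂ᵢθ + θ(2ζ₁ + ζ₂ - γ)/ρ² ∂ᵢρ` (`γ = ζ₀ + ζ₁`). [folklore] -/
private theorem l3pb_chain {σ T : ℝ} {ρ θ : ℝ → T3 → ℝ} {u : ℝ → T3 → V3} {ζ : ℝ → ℝ} {J : Set ℝ}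
    (hE : IsHardSphereEulerSolution σ T ρ u θ) (hJ : IsOpen J) (hζ : ContDiffOn ℝ (⊤ : ℕ∞) ζ J)
    (hρJ : ∀ t ∈ Ico 0 T, ∀ x, ρ t x ∈ J) {t : ℝ} (ht : t ∈ Ico 0 T) (x : T3) (i : Fin 3) :
    Torus.partialDeriv i (fun y => ζ (ρ t y)) x =
        ρ t x * deriv ζ (ρ t x) / ρ t x * Torus.partialDeriv i (ρ t) x ∧
      Torus.partialDeriv i (fun y => θ t y * ζ (ρ t y)) x =
        ζ (ρ t x) * Torus.partialDeriv i (θ t) x +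
          θ t x * (ρ t x * deriv ζ (ρ t x) / ρ t x) * Torus.partialDeriv i (ρ t) x ∧
      Torus.partialDeriv i (fun y => θ t y * (ζ (ρ t y) + ρ t y * deriv ζ (ρ t y)) / ρ t y) x =
        (ζ (ρ t x) + ρ t x * deriv ζ (ρ t x)) / ρ t x * Torus.partialDeriv i (θ t) x +
          θ t x * (2 * (ρ t x * deriv ζ (ρ t x)) + ρ t x ^ 2 * deriv (deriv ζ) (ρ t x) -
            (ζ (ρ t x) + ρ t x * deriv ζ (ρ t x))) / ρ t x ^ 2 * Torus.partialDeriv i (ρ t) x := by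
  have hρs : Torus.IsSmooth (ρ t) := hE.smooth_density.isSmooth_slice ht
  have hθs : Torus.IsSmooth (θ t) := hE.smooth_temperature.isSmooth_slice ht
  have hρ0 : ρ t x ≠ 0 := (hE.density_pos t ht x).ne'
  have hζs : Torus.IsSmooth (fun y => ζ (ρ t y)) := torusJet_isSmooth_comp hJ hζ hρs (hρJ t ht)
  have h1 : Torus.partialDeriv i (fun y => ζ (ρ t y)) x = deriv ζ (ρ t x) * Torus.partialDeriv i (ρ t) x :=
    torusJet_comp_deriv1 hJ hζ hρs (hρJ t ht) i x
  have hγs : Torus.IsSmooth (fun y => ζ (ρ t y) + ρ t y * deriv ζ (ρ t y)) :=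
    torusJet_isSmooth_add hζs (torusJet_isSmooth_mul hρs
      (torusJet_isSmooth_comp hJ (torusJet_contDiffOn_deriv hJ hζ) hρs (hρJ t ht)))
  refine ⟨by rw [h1, mul_div_cancel_left₀ _ hρ0], by
    rw [torusJet_mul_deriv1 hθs hζs i x, h1, mul_div_cancel_left₀ _ hρ0]; ring, ?_⟩
  rw [torusJet_div_deriv1 (torusJet_isSmooth_mul hθs hγs) hρs (fun y => (hE.density_pos t ht y).ne') i x,
    hsEuler_coeffRho_partialDeriv hE hJ hζ hρJ ht x i]
  field_simp
  ring

/-- **Level-3 pairing bound at a point** (see the module docstring). [folklore] -/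
theorem level3_pairing_bound :
    ∀ (K C Cb cZ : ℝ), 0 < K → 0 ≤ C → 0 ≤ Cb → 0 ≤ cZ →
      ∃ Λ : ℝ, 0 ≤ Λ ∧
        ∀ {σ T T₁ : ℝ} {ρ θ ρ₁ θ₁ : ℝ → T3 → ℝ} {u u₁ : ℝ → T3 → V3} {ζ : ℝ → ℝ} {J : Set ℝ},
          IsHardSphereEulerSolution σ T ρ u θ → IsHardSphereEulerSolution 0 T ρ₁ u₁ θ₁ →
          0 < σ → T ≤ T₁ →
          IsOpen J → ContDiffOn ℝ (⊤ : ℕ∞) ζ J → (∀ t ∈ Ico 0 T, ∀ x, ρ t x ∈ J) →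
          (∀ t ∈ Ico 0 T, ∀ x, hsPressure σ (ρ t x) (θ t x) = ρ t x * θ t x * ζ (ρ t x)) →
          (∀ t ∈ Ico 0 T, ∀ x, |ζ (ρ t x) - 1| ≤ cZ * (ρ t x * σ ^ 3) ∧
            |ρ t x * deriv ζ (ρ t x)| ≤ cZ * (ρ t x * σ ^ 3) ∧
            |ρ t x ^ 2 * deriv (deriv ζ) (ρ t x)| ≤ cZ * (ρ t x * σ ^ 3)) →
          (∀ t ∈ Ico 0 T, ∀ x, θ₁ t x = K * ρ₁ t x ^ (2 / 3 : ℝ)) →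
          (∀ t ∈ Ico 0 T, ∀ x, ∀ i : Fin 3,
            ‖Torus.partialDeriv i (u₁ t) x‖ ≤ C / (T₁ - t) ∧
            |Torus.partialDeriv i (fun y => ρ₁ t y ^ (1 / 3 : ℝ)) x| ≤ C / (T₁ - t)) →
          (∀ t ∈ Ico 0 T, ∀ x, |ρ t x - ρ₁ t x| ≤ ρ₁ t x / 2 ∧ |θ t x - θ₁ t x| ≤ θ₁ t x / 2 ∧
            ρ t x * σ ^ 3 * (cZ + 1) ≤ 1 / 8) →
          (∀ t ∈ Ico 0 T, ∀ x, ∀ i : Fin 3,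
            ‖Torus.partialDeriv i (u t) x - Torus.partialDeriv i (u₁ t) x‖ ≤ Cb / (T₁ - t) ∧
            Real.sqrt (θ₁ t x) *
                |Torus.partialDeriv i (ρ t) x - Torus.partialDeriv i (ρ₁ t) x| / ρ₁ t x ≤
              Cb / (T₁ - t) ∧
            |Torus.partialDeriv i (θ t) x - Torus.partialDeriv i (θ₁ t) x| / Real.sqrt (θ₁ t x) ≤
              Cb / (T₁ - t)) →
          ∀ {t : ℝ}, t ∈ Ico 0 T → ∀ (x : T3) {M Z S₂ S₃ d₀ d₁ d₂ : ℝ},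
          0 ≤ M → 0 ≤ Z → 0 ≤ S₂ → 0 ≤ S₃ → 0 ≤ d₀ → 0 ≤ d₁ → 0 ≤ d₂ →
          Level3Coeff ζ ρ θ ρ₁ θ₁ u u₁ t x M Z S₂ S₃ → Level3Jets ρ θ ρ₁ θ₁ u u₁ t x d₀ d₁ d₂ →
          ∀ (l m n : Fin 3),
          θ t x * (ζ (ρ t x) + ρ t x * deriv ζ (ρ t x)) / ρ t x *
              Torus.partialDeriv n (Torus.partialDeriv m (Torus.partialDeriv l (fun y => ρ t y - ρ₁ t y))) x *
              l3Fρ T ρ ρ₁ u u₁ t x l m n +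
            ρ t x * ∑ j, Torus.partialDeriv n (Torus.partialDeriv m (Torus.partialDeriv l
                (fun y => u t y - u₁ t y))) x j * l3Fu T ζ ρ θ ρ₁ θ₁ u u₁ t x l m n j +
            3 / 2 * ρ t x / θ t x *
              Torus.partialDeriv n (Torus.partialDeriv m (Torus.partialDeriv l (fun y => θ t y - θ₁ t y))) x *
              l3Fθ T ζ ρ θ θ₁ u u₁ t x l m n
          ≤ Λ / (T₁ - t) * (l3e ζ ρ θ ρ₁ θ₁ u u₁ l m n t x + l3Y ζ ρ θ ρ₁ θ₁ u u₁ t x l m n) +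
            3 * l3Nw ζ ρ θ ρ₁ θ₁ u u₁ t x l m n * l3Ws ζ ρ θ t x * l3Rem M Z S₂ S₃ d₀ d₁ d₂ := by
  intro K C Cb cZ hK hC hCb hcZ
  obtain ⟨Λ, hΛ0, hΛ⟩ := l3pb_real K C Cb cZ hK hC hCb hcZ
  refine ⟨Λ, hΛ0, ?_⟩
  intro σ T T₁ ρ θ ρ₁ θ₁ u u₁ ζ J hE hE₁ hσ hTT₁ hJ hζ hρJ hp hEos hIs hT1 hweak hwd t ht x M Z S₂ S₃ d₀ d₁ d₂
    hM hZ hS₂ hS₃ hd₀ hd₁ hd₂ hCo hJe l m n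
  -- signs at the point
  have hlam : 0 < T₁ - t := by linarith [ht.2]
  have hρpos := hE.density_pos t ht x
  have hθpos := hE.temperature_pos t ht x
  obtain ⟨hδρ, hδθ, hsmall⟩ := hweak t ht x
  obtain ⟨hζ0, hζ1, hζ2⟩ := hEos t ht x
  have hηh : 0 ≤ ρ t x * σ ^ 3 := by positivity
  have hcs : cZ * (ρ t x * σ ^ 3) ≤ 1 / 8 := by linarith
  have hγ : 0 < ζ (ρ t x) + ρ t x * deriv ζ (ρ t x) := by
    linarith [(abs_le.1 (hζ0.trans hcs)).1, (abs_le.1 (hζ1.trans hcs)).1]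
  have hA0 : 0 ≤ θ t x * (ζ (ρ t x) + ρ t x * deriv ζ (ρ t x)) / ρ t x :=
    div_nonneg (mul_nonneg hθpos.le hγ.le) hρpos.le
  have hB0 : 0 ≤ 3 / 2 * ρ t x / θ t x := by positivity
  -- velocity coordinates
  have hus : Torus.IsSmooth (u t) := hE.smooth_velocity.isSmooth_slice ht
  have hu₁s : Torus.IsSmooth (u₁ t) := hE₁.smooth_velocity.isSmooth_slice ht
  have hUs : Torus.IsSmooth (fun y => u t y - u₁ t y) :=
    (hE.smooth_velocity.sub hE₁.smooth_velocity).isSmooth_slice ht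
  have hcv : ∀ i k o j, Torus.partialDeriv i (Torus.partialDeriv k (Torus.partialDeriv o
      (fun y => u t y j - u₁ t y j))) x = Torus.partialDeriv i (Torus.partialDeriv k (Torus.partialDeriv o
      (fun y => u t y - u₁ t y))) x j := fun i k o j => by
    rw [← torusJet_apply_coord_deriv3 hUs j i k o x]; simp only [PiLp.sub_apply]
  have hdu₁ : ∀ i j, |Torus.partialDeriv i (fun z => u₁ t z j) x| ≤ C / (T₁ - t) := fun i j => by
    rw [torusJet_apply_coord_deriv1 hu₁s j i x, ← Real.norm_eq_abs]
    exact (PiLp.norm_apply_le _ j).trans (hT1 t ht x i).1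
  have hdu : ∀ i j, |Torus.partialDeriv i (fun y => u t y j) x - Torus.partialDeriv i (fun z => u₁ t z j) x| ≤
      Cb / (T₁ - t) := fun i j => by
    rw [torusJet_apply_coord_deriv1 hus j i x, torusJet_apply_coord_deriv1 hu₁s j i x, ← PiLp.sub_apply, ← Real.norm_eq_abs]
    exact (PiLp.norm_apply_le _ j).trans (hwd t ht x i).1
  -- isentropic reference `ρ₁ = c₁³`, `θ₁ = K c₁²`
  obtain ⟨hc₁, hρ₁c, hθ₁c, hsq⟩ := isentropic_pointwise_algebra hK (hE₁.density_pos t ht x) (hIs t ht x)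
  have hdρ₁ := isentropic_partialDeriv_density hE₁ ht x
  have hdθ₁ := isentropic_partialDeriv_temperature hE₁ hK hIs ht x
  generalize ρ₁ t x ^ (1 / 3 : ℝ) = c₁ at hc₁ hρ₁c hθ₁c hsq hdρ₁ hdθ₁
  rw [hρ₁c] at hδρ; rw [hθ₁c] at hδθ
  have hdρ : ∀ i, Real.sqrt K * c₁ * |Torus.partialDeriv i (ρ t) x -
      3 * c₁ ^ 2 * Torus.partialDeriv i (fun y => ρ₁ t y ^ (1 / 3 : ℝ)) x| / c₁ ^ 3 ≤ Cb / (T₁ - t) :=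
    fun i => by have h := (hwd t ht x i).2.1; rwa [hsq, hdρ₁ i, hρ₁c] at h
  have hdθ : ∀ i, |Torus.partialDeriv i (θ t) x -
      2 * K * c₁ * Torus.partialDeriv i (fun y => ρ₁ t y ^ (1 / 3 : ℝ)) x| / (Real.sqrt K * c₁) ≤
      Cb / (T₁ - t) :=
    fun i => by have h := (hwd t ht x i).2.2; rwa [hsq, hdθ₁ i] at h
  -- (1) the top-order part, from the pure real form
  have key := hΛ (T₁ - t) c₁ (ρ t x) (θ t x) (ζ (ρ t x)) (ρ t x * deriv ζ (ρ t x))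
    (ρ t x ^ 2 * deriv (deriv ζ) (ρ t x)) (ρ t x * σ ^ 3)
    (fun i j => Torus.partialDeriv i (fun y => u t y j) x) (fun i j => Torus.partialDeriv i (fun z => u₁ t z j) x)
    (fun i => Torus.partialDeriv i (fun y => ρ₁ t y ^ (1 / 3 : ℝ)) x) (fun i => Torus.partialDeriv i (ρ t) x)
    (fun i => Torus.partialDeriv i (θ t) x)
    (Torus.partialDeriv n (Torus.partialDeriv m (Torus.partialDeriv l (fun y => ρ t y - ρ₁ t y))) x)
    (Torus.partialDeriv n (Torus.partialDeriv m (Torus.partialDeriv l (fun y => θ t y - θ₁ t y))) x)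
    (fun j => Torus.partialDeriv n (Torus.partialDeriv m (Torus.partialDeriv l (fun y => u t y - u₁ t y))) x j)
    (fun i => Torus.partialDeriv n (Torus.partialDeriv m (Torus.partialDeriv i (fun y => ρ t y - ρ₁ t y))) x)
    (fun i => Torus.partialDeriv n (Torus.partialDeriv m (Torus.partialDeriv i (fun y => θ t y - θ₁ t y))) x)
    (fun i => Torus.partialDeriv n (Torus.partialDeriv i (Torus.partialDeriv l (fun y => ρ t y - ρ₁ t y))) x)
    (fun i => Torus.partialDeriv n (Torus.partialDeriv i (Torus.partialDeriv l (fun y => θ t y - θ₁ t y))) x)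
    (fun i => Torus.partialDeriv i (Torus.partialDeriv m (Torus.partialDeriv l (fun y => ρ t y - ρ₁ t y))) x)
    (fun i => Torus.partialDeriv i (Torus.partialDeriv m (Torus.partialDeriv l (fun y => θ t y - θ₁ t y))) x)
    (fun i j => Torus.partialDeriv n (Torus.partialDeriv m (Torus.partialDeriv i (fun y => u t y - u₁ t y))) x j)
    (fun i j => Torus.partialDeriv n (Torus.partialDeriv i (Torus.partialDeriv l (fun y => u t y - u₁ t y))) x j)
    (fun i j => Torus.partialDeriv i (Torus.partialDeriv m (Torus.partialDeriv l (fun y => u t y - u₁ t y))) x j)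
    l m n hlam hc₁ hηh hsmall hζ0 hζ1 hζ2 hδρ hδθ hdu₁ (fun i => (hT1 t ht x i).2) hdu hdρ hdθ
  have htop : θ t x * (ζ (ρ t x) + ρ t x * deriv ζ (ρ t x)) / ρ t x *
        Torus.partialDeriv n (Torus.partialDeriv m (Torus.partialDeriv l (fun y => ρ t y - ρ₁ t y))) x *
        l3Topρ ρ ρ₁ u u₁ t x l m n +
      ρ t x * ∑ j, Torus.partialDeriv n (Torus.partialDeriv m (Torus.partialDeriv l
        (fun y => u t y - u₁ t y))) x j * l3Topu ζ ρ θ ρ₁ θ₁ u u₁ t x l m n j +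
      3 / 2 * ρ t x / θ t x *
        Torus.partialDeriv n (Torus.partialDeriv m (Torus.partialDeriv l (fun y => θ t y - θ₁ t y))) x *
        l3Topθ ζ ρ θ θ₁ u u₁ t x l m n ≤
      Λ / (T₁ - t) * (l3e ζ ρ θ ρ₁ θ₁ u u₁ l m n t x + l3Y ζ ρ θ ρ₁ θ₁ u u₁ t x l m n) := by
    have hch := fun i => l3pb_chain hE hJ hζ hρJ ht x i
    simp only [l3Topρ, l3Topu, l3Topθ, l3Y, l3e, hcv, hdρ₁, hdθ₁, hρ₁c, hθ₁c, (hch _).1, (hch _).2.1,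
      (hch _).2.2, EuclideanSpace.real_norm_sq_eq]
    exact key
  -- (2) the crude part
  have hcrude := l3pb_crude_real
    (a := Torus.partialDeriv n (Torus.partialDeriv m (Torus.partialDeriv l (fun y => ρ t y - ρ₁ t y))) x)
    (b := Torus.partialDeriv n (Torus.partialDeriv m (Torus.partialDeriv l (fun y => θ t y - θ₁ t y))) x)
    hA0 hρpos.le hB0 (level3_crude_density hE hE₁ ht hM hZ hS₂ hS₃ hd₀ hd₁ hd₂ hCo hJe l m n)
    (fun j => level3_crude_velocity hE hE₁ hJ hζ hρJ hp ht hM hZ hS₂ hS₃ hd₀ hd₁ hd₂ hCo hJe l m n j)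
    (level3_crude_temperature hE hE₁ hJ hζ hρJ hp ht hM hZ hS₂ hS₃ hd₀ hd₁ hd₂ hCo hJe l m n)
    (fun j => (Real.norm_eq_abs _).symm.trans_le (PiLp.norm_apply_le (Torus.partialDeriv n
      (Torus.partialDeriv m (Torus.partialDeriv l (fun y => u t y - u₁ t y))) x) j))
  unfold l3Nw l3Ws
  refine le_trans (le_of_eq ?_) (add_le_add htop hcrude)
  simp only [Fin.sum_univ_three]
  ring

end Summit.AtomisticToContinuum.HydrodynamicLimit.Theorems

end
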